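import Summits.BirchSwinnertonDyer.BirchSwinnertonDyer.Theorems.GoldfeldGoodTwistsHalfHalf
import Summits.BirchSwinnertonDyer.BirchSwinnertonDyer.Theorems.GoldfeldGoodTwistsSmithCaseII
import Literature.NumberTheory.EllipticCurves.ComplexMultiplicationHasCMThirteenProofs
import Literature.NumberTheory.EllipticCurves.BSDRankResidualCellsProofs
import Literature.NumberTheory.EllipticCurves.BSDSelmerSmithProofs
import Literature.NumberTheory.EllipticCurves.BSDSelmerSmithDensityProofs
import Literature.NumberTheory.EllipticCurves.BSDSelmerParityDokchitserProofs
import HarnessLib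

/-!
# Goldfeld for the twists of `X₀(49)` from published inputs: the even half over ALL twists

Cell `bsd-goldfeld` (planner seat, generation 2), file 7. Theorems only — no named fact, no axiom,
no definition. Two upgrades of the cell's target (files 3–5), both resting on file 6
(`GoldfeldGoodTwistsSmithCaseII`: Smith's distribution theorem for `E₀ = X₀(49) = 49a1` from the
PUBLISHED [Smi22a] Thm. 1.2 alone, `smith_selmerCorank_density_of_j_eq_neg3375 h22 cm7 j_cm7`).

1. **The cell target from print-level inputs** — `bsdRank_densityOne_twists_of_X049_of_smith2022`,
   `bsdRank_and_goldfeld_twists_of_X049_of_smith2022`: the three clauses of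
   `bsdRank_and_goldfeld_twists_of_X049` (rank BSD with finite `Ш` for `100 %` of the good family
   `𝓕 = {d squarefree : d ≡ 1 (mod 4)}`, rank `0` for `50 %`, rank `1` for `50 %`) with the Smith
   hypothesis `hS : smith_selmerCorank_density cm7` (arXiv:2503.17619 Thm. 1.1, preprint) replaced
   by `h22 : smith2022_selmerCorank_distribution` ([Smi22a] Thm. 1.2, J. Amer. Math. Soc. 39
   (2026)) — compare file 5's `…_of_smith_inputs`, which needs in addition the preprint-only
   Thm. 1.17 (Cases IV/V) and Monsky.

2. **The even-parity half of Goldfeld's conjecture for `X₀(49)` over ALL quadratic twists,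
   caveat-free** — `twistDensity_rankZero_bsd_of_hasCM` (general: an elliptic CM curve `W / ℚ`
   satisfying Smith's distribution statement) and `goldfeld_rankZero_half_allTwists_of_X049`:
   among ALL squarefree `d` (both signs, no congruence condition), the set of `d` with
   `ord_{s=1} L(E₀^{(d)}, s) = 0`, `rank E₀^{(d)}(ℚ) = 0` and `Ш(E₀^{(d)}/ℚ)` finite has natural
   density EXACTLY `1/2`. Inputs: [Smi22a] Thm. 1.2 (`h22`), Burungale–Tian's rank-zero
   `p`-converse for CM curves at `p = 2` (`hBT`, Ann. of Math. 203 (2026), Thm. 1.1 — no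
   good/ordinary hypothesis at `p`, so no restriction on `d`), Gross–Zagier–Kolyvagin (`hGZK`).
   On a squarefree `d` the three conditions are EQUIVALENT to `corank_{ℤ_2} Sel_{2^∞}(E₀^{(d)}) = 0`
   (⟸: `hBT` then `hGZK`; ⟹: finite `Ш` makes the corank equal to the rank,
   `selmerCorank_eq_mordellWeilRank_of_finite_shaPrimary`), and that set has density `1/2` by
   clause 1 of Smith's theorem. The same for every elliptic `W / ℚ` with `j(W) ∈ {−3375, 16581375}`.
   Relation to the tree: the ANALYTIC-RANK-ONLY form of this statement for a CM curve —
   `twistDensity {d : ord_{s=1} L(W^{(d)}, s) = 0} = 1/2` from `hS`, `hBT` and MONSKY's `2`-parity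
   (`hMon`, for the direction `ord L = 0 ⟹ corank even ⟹ 0` on the density-one set) — is already
   the Literature theorem `twistDensity_analyticRank_eq_zero_of_hasCM_of_burungaleTian`
   (`BSDSelmerCMPConverseGoldfeldProofs`, after Burungale–Tian's abstract); the present version
   adds `rank W^{(d)}(ℚ) = 0` and the finiteness of `Ш(W^{(d)}/ℚ)` to the conclusion and uses
   Gross–Zagier–Kolyvagin (`hGZK`) instead of Monsky for the converse direction
   (`rank = 0 ∧ Ш finite ⟹ corank = 0`).
   Also the Cor.-1.3 shape `twistDensity_rankZero_bsd_of_rootNumber_eq_one_of_hasCM`: for `100 %`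
   of the squarefree `d`, `w(W^{(d)}) = +1 ⟹ ord_{s=1} L(W^{(d)}, s) = rank W^{(d)}(ℚ) = 0` and
   `Ш(W^{(d)}/ℚ)` finite (needs `2`-parity: Monsky + Modularity, or the fact `p_parity · 2`).

   (The odd half over all `d` is NOT available this way: the rank-one `2`-converse needs good
   ordinary reduction at `2`, i.e. `d ∈ 𝓕` — files 3–5.)

References: A. Smith, *The distribution of `ℓ^∞`-Selmer groups in degree `ℓ` twist families I*,
J. Amer. Math. Soc. 39 (2026), Thm. 1.2 [Smith2022SelmerTwistI]; A. Smith, arXiv:2503.17619, Thm. 1.1,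
Cor. 1.2–1.3 [arXiv250317619]; A. Burungale, Y. Tian, Ann. of Math. 203 (2026), Thm. 1.1
[BurungaleTian2026]; A. Burungale, F. Castella, C. Skinner, Y. Tian (2022), Thm. A
[BurungaleCastellaSkinnerTian2022]; R. Greenberg, LNM 1716 (1999), §1 [Greenberg1999LNM];
T. Dokchitser, V. Dokchitser, Ann. of Math. 172 (2010), Thm. 1.4 [DokchitserDokchitserAnnals2010];
J. Coates, Y. Li, Y. Tian, S. Zhai, Proc. LMS 110 (2015) [CoatesLiTianZhai2015].
-/

set_option linter.dupNamespace false
set_option autoImplicit false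

noncomputable section

open scoped Classical

open Filter Topology WeierstrassCurve Literature.NumberTheory.EllipticCurves
  Literature.NumberTheory.EllipticCurves.BurungaleCastellaSkinnerTian2022
  Literature.NumberTheory.EllipticCurves.ModularForms

namespace Summit.BirchSwinnertonDyer.BirchSwinnertonDyer.Theorems.GoldfeldGoodTwists

/-! ## §1 One twist of `2^∞`-Selmer corank `0` (any squarefree `d`) -/

/-- **Corank `0` ⟹ rank BSD with rank `0`, for ANY twist of a CM curve.** For `W / ℚ` elliptic with
CM, `d ≠ 0` and `corank_{ℤ_2} Sel_{2^∞}(W^{(d)}/ℚ) = 0`: `ord_{s=1} L(W^{(d)}, s) = 0`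
(Burungale–Tian's rank-zero `2`-converse for the CM curve `W^{(d)}`, `hBT` — no local condition at
`2`), `rank W^{(d)}(ℚ) = 0` and `Ш(W^{(d)}/ℚ)` finite (Gross–Zagier–Kolyvagin, `hGZK`).
[cite: BurungaleTian2026, Thm. 1.1] -/
theorem analyticRank_eq_zero_of_selmerCorankTwoInfty_eq_zero
    (hBT : burungaleTian_analyticRank_eq_zero_of_selmerCorank_eq_zero_of_hasCM)
    (hGZK : rank_eq_analyticRank_of_analyticRank_le_one)
    (W : WeierstrassCurve ℚ) [W.IsElliptic] (hCM : W.HasCM) {d : ℤ} (hd0 : d ≠ 0)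
    (h0 : selmerCorankTwoInfty (W.quadraticTwist d) = 0) :
    (W.quadraticTwist d).analyticRank = 0 ∧ (W.quadraticTwist d).mordellWeilRank = 0 ∧
      Finite (W.quadraticTwist d).sha := by
  have hd0' : ((d : ℤ) : ℚ) ≠ 0 := by exact_mod_cast hd0
  haveI := W.isElliptic_quadraticTwist hd0'
  have hCMd : (W.quadraticTwist (d : ℚ)).HasCM := hasCM_quadraticTwist_of_hasCM W hCM hd0'
  have har : (W.quadraticTwist (d : ℚ)).analyticRank = 0 :=
    hBT _ hCMd 2 ((selmerCorankTwoInfty_eq _).symm.trans h0)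
  obtain ⟨hrank, hsha⟩ := hGZK (W.quadraticTwist (d : ℚ)) (by omega)
  exact ⟨har, by rw [hrank, har], hsha⟩

/-- **Finite `Ш` ⟹ corank = rank** for a twist: if `Ш(W^{(d)}/ℚ)` is finite then
`corank_{ℤ_2} Sel_{2^∞}(W^{(d)}/ℚ) = rank W^{(d)}(ℚ)` (the corank identity
`corank Sel_{2^∞} = rank + corank Ш[2^∞]`, Greenberg 1999, §1). [cite: Greenberg1999LNM, §1 pp. 54–57] -/
theorem selmerCorankTwoInfty_eq_mordellWeilRank_of_finite_sha (W : WeierstrassCurve ℚ)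
    [W.IsElliptic] {d : ℤ} (hd0 : d ≠ 0) (hsha : Finite (W.quadraticTwist d).sha) :
    selmerCorankTwoInfty (W.quadraticTwist d) = (W.quadraticTwist d).mordellWeilRank := by
  have hd0' : ((d : ℤ) : ℚ) ≠ 0 := by exact_mod_cast hd0
  haveI := W.isElliptic_quadraticTwist hd0'
  haveI := hsha
  rw [selmerCorankTwoInfty_eq]
  exact selmerCorank_eq_mordellWeilRank_of_finite_shaPrimary _ 2 inferInstance

/-- On a squarefree `d`, for a CM curve `W`: `corank_{ℤ_2} Sel_{2^∞}(W^{(d)}) = 0` iff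
(`ord_{s=1} L(W^{(d)}, s) = 0`, `rank W^{(d)}(ℚ) = 0` and `Ш(W^{(d)}/ℚ)` finite).
[cite: BurungaleTian2026, Thm. 1.1] [cite: Greenberg1999LNM, §1] -/
theorem selmerCorankTwoInfty_eq_zero_iff_of_hasCM
    (hBT : burungaleTian_analyticRank_eq_zero_of_selmerCorank_eq_zero_of_hasCM)
    (hGZK : rank_eq_analyticRank_of_analyticRank_le_one)
    (W : WeierstrassCurve ℚ) [W.IsElliptic] (hCM : W.HasCM) {d : ℤ} (hd : Squarefree d) :
    (d ≠ 0 ∧ selmerCorankTwoInfty (W.quadraticTwist d) = 0) ↔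
      ((W.quadraticTwist d).analyticRank = 0 ∧ (W.quadraticTwist d).mordellWeilRank = 0 ∧
        Finite (W.quadraticTwist d).sha) := by
  constructor
  · rintro ⟨hd0, h0⟩
    exact analyticRank_eq_zero_of_selmerCorankTwoInfty_eq_zero hBT hGZK W hCM hd0 h0
  · rintro ⟨-, hrank, hsha⟩
    exact ⟨hd.ne_zero,
      by rw [selmerCorankTwoInfty_eq_mordellWeilRank_of_finite_sha W hd.ne_zero hsha, hrank]⟩

/-! ## §2 The even half of Goldfeld over ALL twists of a CM curve -/

/-- **Even-parity Goldfeld, with BSD, over all quadratic twists of a CM curve.** Let `W / ℚ` be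
an elliptic curve with complex multiplication for which Smith's distribution statement holds
(`hS`: corank `0` for density `1/2` of the squarefree `d`), and assume Burungale–Tian's rank-zero
`p`-converse (`hBT`) and Gross–Zagier–Kolyvagin (`hGZK`). Then among ALL squarefree `d` (ordered
by `|d|`, both signs) the set of `d` with `ord_{s=1} L(W^{(d)}, s) = 0`, `rank W^{(d)}(ℚ) = 0` and
`Ш(W^{(d)}/ℚ)` finite has natural density exactly `1/2`
(`selmerCorankTwoInfty_eq_zero_iff_of_hasCM` + `twistDensity_congr`). The analytic-rank-only form
(with Monsky's `2`-parity in place of `hGZK`) is the tree's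
`twistDensity_analyticRank_eq_zero_of_hasCM_of_burungaleTian`; this version adds `rank = 0` and
`Ш` finite. [cite: arXiv250317619, Thm. 1.1 and Cor. 1.2] [cite: BurungaleTian2026, Thm. 1.1 and Thm. 1.2] -/
theorem twistDensity_rankZero_bsd_of_hasCM
    (hBT : burungaleTian_analyticRank_eq_zero_of_selmerCorank_eq_zero_of_hasCM)
    (hGZK : rank_eq_analyticRank_of_analyticRank_le_one)
    (W : WeierstrassCurve ℚ) [W.IsElliptic] (hCM : W.HasCM) (hS : smith_selmerCorank_density W) :
    twistDensity (fun d ↦ (W.quadraticTwist d).analyticRank = 0 ∧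
      (W.quadraticTwist d).mordellWeilRank = 0 ∧ Finite (W.quadraticTwist d).sha) (1 / 2) :=
  (twistDensity_congr (P := fun d : ℤ ↦ d ≠ 0 ∧ selmerCorankTwoInfty (W.quadraticTwist d) = 0)
    (fun _ hd ↦ selmerCorankTwoInfty_eq_zero_iff_of_hasCM hBT hGZK W hCM hd) _).mp hS.1

/-- The complementary half: among all squarefree `d`, the set of `d` for which NOT
(`ord_{s=1} L(W^{(d)}, s) = 0 ∧ rank W^{(d)}(ℚ) = 0 ∧ Ш(W^{(d)}/ℚ)` finite) — by Smith's theorem, up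
to a density-`0` set these are the `d` with `corank_{ℤ_2} Sel_{2^∞}(W^{(d)}) = 1` — also has
density `1/2`. [cite: arXiv250317619, Thm. 1.1] -/
theorem twistDensity_not_rankZero_bsd_of_hasCM
    (hBT : burungaleTian_analyticRank_eq_zero_of_selmerCorank_eq_zero_of_hasCM)
    (hGZK : rank_eq_analyticRank_of_analyticRank_le_one)
    (W : WeierstrassCurve ℚ) [W.IsElliptic] (hCM : W.HasCM) (hS : smith_selmerCorank_density W) :
    twistDensity (fun d ↦ ¬ ((W.quadraticTwist d).analyticRank = 0 ∧
      (W.quadraticTwist d).mordellWeilRank = 0 ∧ Finite (W.quadraticTwist d).sha)) (1 / 2) := by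
  have h := (twistDensity_rankZero_bsd_of_hasCM hBT hGZK W hCM hS).compl
  rwa [show (1 : ℝ) - 1 / 2 = 1 / 2 by norm_num] at h

/-- **Cor. 1.3 shape, with BSD: `100 %` of the even-parity twists of a CM curve have
`ord_{s=1} L = rank = 0` and finite `Ш`.** For `W / ℚ` elliptic with CM satisfying Smith's
distribution statement (`hS`), given `2`-parity `(−1)^{corank Sel_{2^∞}(E')} = w(E')` for every
elliptic `E' / ℚ` (`hpar`: Dokchitser–Dokchitser / Monsky), `hBT` and `hGZK`: the squarefree `d`
with "`w(W^{(d)}) = +1 ⟹ ord_{s=1} L(W^{(d)}, s) = 0 ∧ rank W^{(d)}(ℚ) = 0 ∧ Ш(W^{(d)}/ℚ)` finite"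
have density `1` (on Smith's density-`1` set `{corank ≤ 1}`, `w = +1` forces corank `0`).
[cite: arXiv250317619, Cor. 1.3] [cite: DokchitserDokchitserAnnals2010, Thm. 1.4]
[cite: BurungaleTian2026, Thm. 1.1] -/
theorem twistDensity_rankZero_bsd_of_rootNumber_eq_one_of_hasCM
    (hBT : burungaleTian_analyticRank_eq_zero_of_selmerCorank_eq_zero_of_hasCM)
    (hGZK : rank_eq_analyticRank_of_analyticRank_le_one)
    (hpar : ∀ (E : WeierstrassCurve ℚ) [E.IsElliptic], p_parity E 2)
    (W : WeierstrassCurve ℚ) [W.IsElliptic] (hCM : W.HasCM) (hS : smith_selmerCorank_density W) :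
    twistDensity (fun d ↦ d ≠ 0 → (W.quadraticTwist d).rootNumber = 1 →
      ((W.quadraticTwist d).analyticRank = 0 ∧ (W.quadraticTwist d).mordellWeilRank = 0 ∧
        Finite (W.quadraticTwist d).sha)) 1 := by
  refine twistDensity_one_mono (fun d _ hd hd0 hw ↦ ?_)
    (twistDensity_selmerCorankTwoInfty_le_one_of W hS)
  obtain ⟨-, hc⟩ := hd
  haveI := W.isElliptic_quadraticTwist (d := (d : ℚ)) (by exact_mod_cast hd0)
  have h2 : (-1 : ℤ) ^ (W.quadraticTwist (d : ℚ)).selmerCorank 2 =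
      (W.quadraticTwist (d : ℚ)).rootNumber := hpar _
  rw [hw, ← selmerCorankTwoInfty_eq] at h2
  have hc1 : selmerCorankTwoInfty (W.quadraticTwist (d : ℚ)) ≠ 1 := fun h1 ↦ by
    rw [h1] at h2
    norm_num at h2
  exact analyticRank_eq_zero_of_selmerCorankTwoInfty_eq_zero hBT hGZK W hCM hd0 (by omega)

/-- The same with the `2`-parity input taken from its sources in the tree: Monsky's congruence
`corank_{ℤ_2} Sel_{2^∞}(E') ≡ ord_{s=1} L(E', s) (mod 2)` (`hMon`) and the Modularity Theorem
(`hmod`, root number = sign of the functional equation), combined by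
`p_parity_of_selmerCorank_mod_two_eq_of_exists_isNewformOf`.
[cite: arXiv250317619, Cor. 1.3] [cite: DokchitserDokchitserAnnals2010, §4.6 (case p = 2)]
[cite: BCDTJAMS2001, Thm. A] [cite: BurungaleTian2026, Thm. 1.1] -/
theorem twistDensity_rankZero_bsd_of_rootNumber_eq_one_of_hasCM_of_exists_isNewformOf
    (hBT : burungaleTian_analyticRank_eq_zero_of_selmerCorank_eq_zero_of_hasCM)
    (hGZK : rank_eq_analyticRank_of_analyticRank_le_one) (hmod : exists_isNewformOf)
    (hMon : monsky_selmerCorank_two_mod_two_eq)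
    (W : WeierstrassCurve ℚ) [W.IsElliptic] (hCM : W.HasCM) (hS : smith_selmerCorank_density W) :
    twistDensity (fun d ↦ d ≠ 0 → (W.quadraticTwist d).rootNumber = 1 →
      ((W.quadraticTwist d).analyticRank = 0 ∧ (W.quadraticTwist d).mordellWeilRank = 0 ∧
        Finite (W.quadraticTwist d).sha)) 1 :=
  twistDensity_rankZero_bsd_of_rootNumber_eq_one_of_hasCM hBT hGZK
    (fun E _ ↦ p_parity_of_selmerCorank_mod_two_eq_of_exists_isNewformOf E 2 hmod (hMon.apply E))
    W hCM hS

/-! ## §3 The `ℚ(√−7)`-curves: every `W` with `j(W) ∈ {−3375, 16581375}`, from [Smi22a] Thm. 1.2 -/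

/-- **Even-parity Goldfeld with BSD for every elliptic `W / ℚ` with `j(W) = −3375`** (the `ℚ`-curves
with CM by `ℤ[(1+√−7)/2]`, i.e. the twists of `49a1`): among all squarefree `d`, density exactly
`1/2` of `ord_{s=1} L(W^{(d)}, s) = 0 ∧ rank W^{(d)}(ℚ) = 0 ∧ Ш(W^{(d)}/ℚ)` finite. Inputs:
[Smi22a] Thm. 1.2 (`h22`, via file 6: these curves are in Case II), Burungale–Tian (`hBT`),
Gross–Zagier–Kolyvagin (`hGZK`); CM by `hasCM_of_j_eq_neg3375`.
[cite: Smith2022SelmerTwistI, Thm. 1.2] [cite: BurungaleTian2026, Thm. 1.1] -/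
theorem goldfeld_rankZero_half_allTwists_of_j_eq_neg3375
    (h22 : smith2022_selmerCorank_distribution)
    (hBT : burungaleTian_analyticRank_eq_zero_of_selmerCorank_eq_zero_of_hasCM)
    (hGZK : rank_eq_analyticRank_of_analyticRank_le_one)
    (W : WeierstrassCurve ℚ) [W.IsElliptic] (hj : W.j = -3375) :
    twistDensity (fun d ↦ (W.quadraticTwist d).analyticRank = 0 ∧
      (W.quadraticTwist d).mordellWeilRank = 0 ∧ Finite (W.quadraticTwist d).sha) (1 / 2) :=
  twistDensity_rankZero_bsd_of_hasCM hBT hGZK W (hasCM_of_j_eq_neg3375 W hj)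
    (smith_selmerCorank_density_of_j_eq_neg3375 h22 W hj)

/-- **The same for `j(W) = 16581375 = 255³`** (CM by the order `ℤ[√−7]`, the twists of `49a2`).
[cite: Smith2022SelmerTwistI, Thm. 1.2] [cite: BurungaleTian2026, Thm. 1.1] -/
theorem goldfeld_rankZero_half_allTwists_of_j_eq_16581375
    (h22 : smith2022_selmerCorank_distribution)
    (hBT : burungaleTian_analyticRank_eq_zero_of_selmerCorank_eq_zero_of_hasCM)
    (hGZK : rank_eq_analyticRank_of_analyticRank_le_one)
    (W : WeierstrassCurve ℚ) [W.IsElliptic] (hj : W.j = 16581375) :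
    twistDensity (fun d ↦ (W.quadraticTwist d).analyticRank = 0 ∧
      (W.quadraticTwist d).mordellWeilRank = 0 ∧ Finite (W.quadraticTwist d).sha) (1 / 2) :=
  twistDensity_rankZero_bsd_of_hasCM hBT hGZK W (hasCM_of_j_eq_16581375 W hj)
    (smith_selmerCorank_density_of_j_eq_16581375 h22 W hj)

/-! ## §4 `E₀ = X₀(49) = 49a1` -/

/-- **The even half of Goldfeld's conjecture for `X₀(49)`, with BSD, over ALL quadratic twists,
from published inputs.** For `E₀ = 49a1` (`cm7 = [1, −1, 0, −2, −1]`): among all squarefree `d`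
the set of `d` with `L(E₀^{(d)}, 1) ≠ 0` (`ord_{s=1} = 0`), `rank E₀^{(d)}(ℚ) = 0` and
`Ш(E₀^{(d)}/ℚ)` finite has natural density exactly `1/2`. Hypotheses: [Smi22a] Thm. 1.2
(`h22`, J. Amer. Math. Soc. 39 (2026)), Burungale–Tian Thm. 1.1 (`hBT`, Ann. of Math. 203 (2026)),
Gross–Zagier–Kolyvagin (`hGZK`) — the tree's named facts, all published.
[cite: Smith2022SelmerTwistI, Thm. 1.2] [cite: BurungaleTian2026, Thm. 1.1]
[cite: CoatesLiTianZhai2015, Thm. 1.1 (context)] -/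
theorem goldfeld_rankZero_half_allTwists_of_X049 (h22 : smith2022_selmerCorank_distribution)
    (hBT : burungaleTian_analyticRank_eq_zero_of_selmerCorank_eq_zero_of_hasCM)
    (hGZK : rank_eq_analyticRank_of_analyticRank_le_one) :
    twistDensity (fun d ↦ (cm7.quadraticTwist d).analyticRank = 0 ∧
      (cm7.quadraticTwist d).mordellWeilRank = 0 ∧ Finite (cm7.quadraticTwist d).sha) (1 / 2) :=
  goldfeld_rankZero_half_allTwists_of_j_eq_neg3375 h22 hBT hGZK cm7 j_cm7

/-- The same, unfolded: `#{d squarefree, |d| ≤ X : ord_{s=1} L(E₀^{(d)}, s) = rank E₀^{(d)}(ℚ) = 0,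
Ш(E₀^{(d)}/ℚ) finite} / #{d squarefree, |d| ≤ X} → 1/2`. [cite: Smith2022SelmerTwistI, Thm. 1.2]
[cite: BurungaleTian2026, Thm. 1.1] -/
theorem tendsto_rankZero_half_allTwists_of_X049 (h22 : smith2022_selmerCorank_distribution)
    (hBT : burungaleTian_analyticRank_eq_zero_of_selmerCorank_eq_zero_of_hasCM)
    (hGZK : rank_eq_analyticRank_of_analyticRank_le_one) :
    Tendsto (fun X : ℕ ↦ (Nat.card {d : ℤ | Squarefree d ∧ |d| ≤ (X : ℤ) ∧
        ((cm7.quadraticTwist d).analyticRank = 0 ∧ (cm7.quadraticTwist d).mordellWeilRank = 0 ∧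
          Finite (cm7.quadraticTwist d).sha)} : ℝ) /
      Nat.card {d : ℤ | Squarefree d ∧ |d| ≤ (X : ℤ)}) atTop (𝓝 (1 / 2)) :=
  goldfeld_rankZero_half_allTwists_of_X049 h22 hBT hGZK

/-- **`100 %` of the even-parity twists of `X₀(49)` have `L(E₀^{(d)}, 1) ≠ 0`, rank `0` and finite
`Ш`** (all squarefree `d`; `2`-parity from Monsky + Modularity).
[cite: arXiv250317619, Cor. 1.3] [cite: Smith2022SelmerTwistI, Thm. 1.2] [cite: BurungaleTian2026, Thm. 1.1] -/
theorem rankZero_bsd_of_rootNumber_eq_one_allTwists_of_X049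
    (h22 : smith2022_selmerCorank_distribution)
    (hBT : burungaleTian_analyticRank_eq_zero_of_selmerCorank_eq_zero_of_hasCM)
    (hGZK : rank_eq_analyticRank_of_analyticRank_le_one) (hmod : exists_isNewformOf)
    (hMon : monsky_selmerCorank_two_mod_two_eq) :
    twistDensity (fun d ↦ d ≠ 0 → (cm7.quadraticTwist d).rootNumber = 1 →
      ((cm7.quadraticTwist d).analyticRank = 0 ∧ (cm7.quadraticTwist d).mordellWeilRank = 0 ∧
        Finite (cm7.quadraticTwist d).sha)) 1 :=
  twistDensity_rankZero_bsd_of_rootNumber_eq_one_of_hasCM_of_exists_isNewformOf hBT hGZK hmod hMon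
    cm7 (hasCM_of_j_eq_neg3375 cm7 j_cm7) (smith_selmerCorank_density_of_j_eq_neg3375 h22 cm7 j_cm7)

/-! ## §5 The cell target from print-level inputs -/

/-- **Rank BSD for `100 %` of the good quadratic twists of `X₀(49)`, from [Smi22a] Thm. 1.2**: the
cell target `bsdRank_densityOne_twists_of_X049` with `hS` discharged by file 6 — for a set of
`d ∈ 𝓕 = {d squarefree : d ≡ 1 (mod 4)}` of relative density `1`,
`ord_{s=1} L(E₀^{(d)}, s) = rank E₀^{(d)}(ℚ)` and `Ш(E₀^{(d)}/ℚ)` is finite. Hypotheses: `h22`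
([Smi22a] Thm. 1.2), `hBT` (Burungale–Tian), `hA` (BCST Thm. A, used at `p = 2` — see the scope
caveat in file 3's header), `hGZK`. [cite: Smith2022SelmerTwistI, Thm. 1.2]
[cite: BurungaleTian2026, Thm. 1.1] [cite: BurungaleCastellaSkinnerTian2022, Thm. A] -/
theorem bsdRank_densityOne_twists_of_X049_of_smith2022 (h22 : smith2022_selmerCorank_distribution)
    (hBT : burungaleTian_analyticRank_eq_zero_of_selmerCorank_eq_zero_of_hasCM)
    (hA : thmA_analyticRank_eq_one_of_selmerCorank_eq_one)
    (hGZK : rank_eq_analyticRank_of_analyticRank_le_one) :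
    Tendsto (fun X : ℕ ↦ (Nat.card {d : ℤ | Squarefree d ∧ |d| ≤ (X : ℤ) ∧ (d % 4 = 1 ∧
        ((cm7.quadraticTwist d).analyticRank = (cm7.quadraticTwist d).mordellWeilRank ∧
          Finite (cm7.quadraticTwist d).sha))} : ℝ) /
      Nat.card {d : ℤ | Squarefree d ∧ |d| ≤ (X : ℤ) ∧ d % 4 = 1}) atTop (𝓝 1) :=
  bsdRank_densityOne_twists_of_X049 (smith_selmerCorank_density_of_j_eq_neg3375 h22 cm7 j_cm7) hBT hA hGZK

/-- **The cell target, all clauses, from print-level inputs**: (i) rank BSD with finite `Ш` for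
`100 %` of `𝓕`; (ii) rank `0` (`= ord_{s=1} L`) for `50 %` of `𝓕`; (iii) rank `1` for `50 %` of
`𝓕` — with Smith's input the PUBLISHED [Smi22a] Thm. 1.2 (`h22`) instead of arXiv:2503.17619
Thm. 1.1 (compare file 5's `bsdRank_and_goldfeld_twists_of_X049_of_smith_inputs`, which needs in
addition Thm. 1.17 Cases IV/V and Monsky). [cite: Smith2022SelmerTwistI, Thm. 1.2]
[cite: BurungaleTian2026, Thm. 1.1] [cite: BurungaleCastellaSkinnerTian2022, Thm. A] -/
theorem bsdRank_and_goldfeld_twists_of_X049_of_smith2022 (h22 : smith2022_selmerCorank_distribution)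
    (hBT : burungaleTian_analyticRank_eq_zero_of_selmerCorank_eq_zero_of_hasCM)
    (hA : thmA_analyticRank_eq_one_of_selmerCorank_eq_one)
    (hGZK : rank_eq_analyticRank_of_analyticRank_le_one) (hmod : exists_isNewformOf) :
    Tendsto (fun X : ℕ ↦ (Nat.card {d : ℤ | Squarefree d ∧ |d| ≤ (X : ℤ) ∧ (d % 4 = 1 ∧
        ((cm7.quadraticTwist d).analyticRank = (cm7.quadraticTwist d).mordellWeilRank ∧
          Finite (cm7.quadraticTwist d).sha))} : ℝ) /
      Nat.card {d : ℤ | Squarefree d ∧ |d| ≤ (X : ℤ) ∧ d % 4 = 1}) atTop (𝓝 1) ∧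
    Tendsto (fun X : ℕ ↦ (Nat.card {d : ℤ | Squarefree d ∧ |d| ≤ (X : ℤ) ∧ (d % 4 = 1 ∧
        ((cm7.quadraticTwist d).analyticRank = 0 ∧ (cm7.quadraticTwist d).mordellWeilRank = 0 ∧
          Finite (cm7.quadraticTwist d).sha))} : ℝ) /
      Nat.card {d : ℤ | Squarefree d ∧ |d| ≤ (X : ℤ) ∧ d % 4 = 1}) atTop (𝓝 (1 / 2)) ∧
    Tendsto (fun X : ℕ ↦ (Nat.card {d : ℤ | Squarefree d ∧ |d| ≤ (X : ℤ) ∧ (d % 4 = 1 ∧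
        ((cm7.quadraticTwist d).analyticRank = 1 ∧ (cm7.quadraticTwist d).mordellWeilRank = 1 ∧
          Finite (cm7.quadraticTwist d).sha))} : ℝ) /
      Nat.card {d : ℤ | Squarefree d ∧ |d| ≤ (X : ℤ) ∧ d % 4 = 1}) atTop (𝓝 (1 / 2)) :=
  bsdRank_and_goldfeld_twists_of_X049 (smith_selmerCorank_density_of_j_eq_neg3375 h22 cm7 j_cm7) hBT hA hGZK
    hmod

/-- **Headline of the cell, print-level form.** For `E₀ = X₀(49) = 49a1`, assuming the published
theorems [Smi22a] Thm. 1.2 (`h22`), Burungale–Tian Thm. 1.1 (`hBT`), Gross–Zagier–Kolyvagin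
(`hGZK`), Modularity (`hmod`) and BCST Thm. A (`hA`, at `p = 2`): (a) over ALL squarefree `d`,
exactly `50 %` of the twists `E₀^{(d)}` have `ord_{s=1} L = rank = 0` and finite `Ш` (uses only
`h22`, `hBT`, `hGZK`); (b) in the good family `𝓕 = {d ≡ 1 (mod 4)}`, `100 %` satisfy rank BSD with
finite `Ш`, and (c) `50 %` have `ord_{s=1} L = rank = 1` with finite `Ш`.
[cite: Smith2022SelmerTwistI, Thm. 1.2] [cite: BurungaleTian2026, Thm. 1.1]
[cite: BurungaleCastellaSkinnerTian2022, Thm. A] [cite: arXiv250317619, Cor. 1.2 (context)] -/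
theorem goldfeld_twists_of_X049_of_published (h22 : smith2022_selmerCorank_distribution)
    (hBT : burungaleTian_analyticRank_eq_zero_of_selmerCorank_eq_zero_of_hasCM)
    (hGZK : rank_eq_analyticRank_of_analyticRank_le_one) (hmod : exists_isNewformOf)
    (hA : thmA_analyticRank_eq_one_of_selmerCorank_eq_one) :
    twistDensity (fun d ↦ (cm7.quadraticTwist d).analyticRank = 0 ∧
      (cm7.quadraticTwist d).mordellWeilRank = 0 ∧ Finite (cm7.quadraticTwist d).sha) (1 / 2) ∧
    Tendsto (fun X : ℕ ↦ (Nat.card {d : ℤ | Squarefree d ∧ |d| ≤ (X : ℤ) ∧ (d % 4 = 1 ∧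
        ((cm7.quadraticTwist d).analyticRank = (cm7.quadraticTwist d).mordellWeilRank ∧
          Finite (cm7.quadraticTwist d).sha))} : ℝ) /
      Nat.card {d : ℤ | Squarefree d ∧ |d| ≤ (X : ℤ) ∧ d % 4 = 1}) atTop (𝓝 1) ∧
    Tendsto (fun X : ℕ ↦ (Nat.card {d : ℤ | Squarefree d ∧ |d| ≤ (X : ℤ) ∧ (d % 4 = 1 ∧
        ((cm7.quadraticTwist d).analyticRank = 1 ∧ (cm7.quadraticTwist d).mordellWeilRank = 1 ∧
          Finite (cm7.quadraticTwist d).sha))} : ℝ) /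
      Nat.card {d : ℤ | Squarefree d ∧ |d| ≤ (X : ℤ) ∧ d % 4 = 1}) atTop (𝓝 (1 / 2)) :=
  ⟨goldfeld_rankZero_half_allTwists_of_X049 h22 hBT hGZK,
    bsdRank_densityOne_twists_of_X049_of_smith2022 h22 hBT hA hGZK,
    (bsdRank_and_goldfeld_twists_of_X049_of_smith2022 h22 hBT hA hGZK hmod).2.2⟩

end Summit.BirchSwinnertonDyer.BirchSwinnertonDyer.Theorems.GoldfeldGoodTwists

end
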